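import Summits.ResolutionOfSingularities.ResolutionOfSingularities.Theorems.FrobeniusLadderFInjectiveMacaulayficationAssocGradedGrading
import Summits.ResolutionOfSingularities.ResolutionOfSingularities.Theorems.FrobeniusLadderFInjectiveMacaulayficationGradedVertexCMFI
import Mathlib.RingTheory.Localization.Away.Basic
import Mathlib.RingTheory.Localization.LocalizationLocalization
import HarnessLib

/-!
# The vertex of `G(F)` and the Hashimoto bridge `cmfiCl_of_vertex_of_hashimoto` (Hashimoto bridge (β), part 2)
# (crux `FInjectiveMacaulayfication` stmt-ResolutionOfSingularities-15315, chain w45a, THEOREM-D programme (A1); consumer shape = res-L1-w45a-idea-1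
# `ThmDSig.lean` r18.1 §3d `cmfiCl_of_vertex`; res-L1-w45a-plan-1 R16.8 (1) / R16.20; seat res-L1-w45a-stub-2)

[OURS · L1 W4.5a] Support file (`--supports stmt-ResolutionOfSingularities-15315 --as helper`); NOT a statement of any manuscript; one DEFINITION (the
augmentation `ε : G(F) → 𝒪/𝔪`) + CONDITIONAL results (Hashimoto 2010 Cor. 5.2 as the spelled-out hypothesis `hH` = token text of the queued named
fact `Hashimoto2010_cmfi_of_homogeneousCore` at universe 0; Cor. 4.7 = named fact `Hashimoto2010_cmfiLocalizes`); AI-written (AI review is weaker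
than expert review).

§1 For a local `(𝒪, 𝔪)` and a filtration `F` with `I₁ ≠ 𝒪`, the AUGMENTATION `ε : G(F) → 𝒪/𝔪` (constant coefficient modulo `𝔪`; multiplicative
because the positive coefficients of `𝓡(F)` lie in `I₁ ⊆ 𝔪`), killing `T⁻¹`, the image of `𝔪` and every `ā·Tⁿ`, `n ≥ 1`; surjective, so
`𝔑 := ker ε` is a maximal ideal — the VERTEX — and it contains every proper homogeneous ideal (a degree-0 homogeneous element outside `𝔑` is a
unit). §2 Transport along `G(F) ≅ G(F)[1/1̄·T⁰]` (localisation at `1`) and the bridge in the §3d shape: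
`cmfiCl_of_vertex_of_hashimoto (hH) (hL) (hNoeth : IsNoetherianRing G(F)) (h𝔑 : CMFI at every maximal 𝔑 with the vertex condition) :
CMFI at every prime of G(F)[1/1̄·T⁰]` — by `GradedVertexCMFI.cmfi_atPrime_of_vertex` over the grading `AssocGradedGrading.gradedRing`.
The §3d binder `hV` (a Veronese exponent) is replaced by its consequence `hNoeth` (`G(F)` Noetherian), which is what Hashimoto's theorem consumes;
`hV ⇒ hNoeth` (finite generation of the Rees algebra) is not proved here. [cite: Hashimoto2010, Cor. 4.7; Cor. 5.2]
-/

-- single-problem summit: the doubled namespace component is forced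
set_option linter.dupNamespace false
-- the quotient-of-subalgebra cone `assocGraded F` makes instance synthesis slow (as in `…PuncturedFullOfPrimes`); generous budgets, no change of meaning
set_option synthInstance.maxHeartbeats 400000
set_option maxHeartbeats 1600000

noncomputable section

namespace Summit.ResolutionOfSingularities.ResolutionOfSingularities.Theorems.FInjectiveMacaulayfication.AssocGradedVertex

open IsLocalRing
open Summit.ResolutionOfSingularities.ResolutionOfSingularities.Theorems.FInjectiveMacaulayfication
open GDD LaurentPolynomial AssocGradedGrading

variable {𝒪 : Type} [CommRing 𝒪] [IsLocalRing 𝒪] (F : MultFiltration 𝒪)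

/-! ## §1 The augmentation `ε : G(F) → 𝒪/𝔪` and the vertex -/

/-- Positive coefficients of `𝓡(F)` lie in `𝔪` (when `I₁ ≠ 𝒪`). [plumbing] -/
theorem coeff_mem_maximalIdeal (hI : F.I 1 ≠ ⊤) (f : extRees F) {m : ℤ} (hm : 0 < m) :
    (f : LaurentPolynomial 𝒪).coeff m ∈ maximalIdeal 𝒪 := by
  have h := coeff_val_mem F f m.toNat
  rw [Int.toNat_of_nonneg hm.le] at h
  exact le_maximalIdeal hI (I_le_of_le F (by omega) h)

/-- The constant coefficient modulo `𝔪` is multiplicative on `𝓡(F)` (when `I₁ ≠ 𝒪`). [folklore] -/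
theorem residue_coeff_zero_mul (hI : F.I 1 ≠ ⊤) (f g : extRees F) :
    residue 𝒪 (((f * g : extRees F) : LaurentPolynomial 𝒪).coeff 0) =
      residue 𝒪 ((f : LaurentPolynomial 𝒪).coeff 0) * residue 𝒪 ((g : LaurentPolynomial 𝒪).coeff 0) := by
  classical
  rw [Subalgebra.coe_mul, AddMonoidAlgebra.coeff_mul_apply_left, Finsupp.sum, map_sum, ← map_mul]
  rw [Finset.sum_eq_single (0 : ℤ)]
  · simp only [neg_zero, add_zero]
  · intro i _ hi
    rw [residue_eq_zero_iff]
    rcases lt_or_gt_of_ne hi with hi' | hi'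
    · exact Ideal.mul_mem_left _ _ (coeff_mem_maximalIdeal F hI g (by omega))
    · exact Ideal.mul_mem_right _ _ (coeff_mem_maximalIdeal F hI f hi')
  · intro h0
    rw [Finsupp.notMem_support_iff.mp h0, zero_mul, map_zero]

/-- The augmentation on `𝓡(F)`: `f ↦ (coeff₀ f) mod 𝔪`. [OURS plumbing definition] -/
def augRees (hI : F.I 1 ≠ ⊤) : extRees F →+* ResidueField 𝒪 where
  toFun f := residue 𝒪 ((f : LaurentPolynomial 𝒪).coeff 0)
  map_one' := by
    rw [Subalgebra.coe_one, AddMonoidAlgebra.one_def, AddMonoidAlgebra.coeff_single, Finsupp.single_eq_same, map_one]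
  map_mul' f g := residue_coeff_zero_mul F hI f g
  map_zero' := by
    rw [ZeroMemClass.coe_zero, AddMonoidAlgebra.coeff_zero, Finsupp.zero_apply, map_zero]
  map_add' f g := by
    rw [AddMemClass.coe_add, AddMonoidAlgebra.coeff_add, Finsupp.add_apply, map_add]

/-- `augRees` kills `T⁻¹`. [plumbing] -/
theorem augRees_sInv (hI : F.I 1 ≠ ⊤) : augRees F hI (sInv F) = 0 := by
  change residue 𝒪 ((sInv F : LaurentPolynomial 𝒪).coeff 0) = 0
  rw [coe_sInv, T, AddMonoidAlgebra.coeff_single, Finsupp.single_apply, if_neg (by norm_num), map_zero]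

/-- **The augmentation `ε : G(F) → 𝒪/𝔪`** (constant coefficient modulo `𝔪`; `T⁻¹ ↦ 0`). [OURS definition] -/
def aug (hI : F.I 1 ≠ ⊤) : assocGraded F →+* ResidueField 𝒪 :=
  Ideal.Quotient.lift (Ideal.span {sInv F}) (augRees F hI) fun a ha => by
    obtain ⟨b, rfl⟩ := Ideal.mem_span_singleton'.mp ha
    rw [map_mul, augRees_sInv, mul_zero]

/-- `ε` on `𝒪`: `ε(x) = x mod 𝔪`. [plumbing] -/
theorem aug_algebraMap (hI : F.I 1 ≠ ⊤) (x : 𝒪) :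
    aug F hI (algebraMap 𝒪 (assocGraded F) x) = residue 𝒪 x := by
  rw [← Ideal.Quotient.mk_algebraMap]
  unfold aug
  rw [Ideal.Quotient.lift_mk]
  change residue 𝒪 (((algebraMap 𝒪 (extRees F) x : extRees F) : LaurentPolynomial 𝒪).coeff 0) = _
  rw [Subalgebra.coe_algebraMap, LaurentPolynomial.algebraMap_apply, Algebra.algebraMap_self, RingHom.id_apply, ← single_eq_C,
    AddMonoidAlgebra.coeff_single, Finsupp.single_eq_same]

/-- `ε(ā·Tⁿ) = 0` for `n ≥ 1`. [plumbing] -/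
theorem aug_homogBar (hI : F.I 1 ≠ ⊤) (n : ℕ) (hn : 0 < n) (a : 𝒪) (ha : a ∈ F.I n) : aug F hI (homogBar F n a ha) = 0 := by
  unfold homogBar aug
  rw [Ideal.Quotient.lift_mk]
  change residue 𝒪 ((homog F n a ha : LaurentPolynomial 𝒪).coeff 0) = 0
  rw [coe_homog, AddMonoidAlgebra.coeff_single, Finsupp.single_apply, if_neg (by exact_mod_cast hn.ne'), map_zero]

omit [IsLocalRing 𝒪] in
/-- `ā·T⁰ = a` (the image of `a ∈ 𝒪` in `G(F)`). [plumbing] -/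
theorem homogBar_zero_eq_algebraMap (a : 𝒪) (ha : a ∈ F.I 0) : homogBar F 0 a ha = algebraMap 𝒪 (assocGraded F) a := by
  rw [← Ideal.Quotient.mk_algebraMap]
  unfold homogBar
  congr 1
  apply Subtype.ext
  rw [Subalgebra.coe_algebraMap, LaurentPolynomial.algebraMap_apply, Algebra.algebraMap_self, RingHom.id_apply]
  change C a * T ((0 : ℕ) : ℤ) = C a
  rw [Nat.cast_zero, T_zero, mul_one]

/-- `ε` is surjective. [plumbing] -/
theorem aug_surjective (hI : F.I 1 ≠ ⊤) : Function.Surjective (aug F hI) := by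
  intro y
  obtain ⟨x, rfl⟩ := residue_surjective y
  exact ⟨algebraMap 𝒪 (assocGraded F) x, aug_algebraMap F hI x⟩

/-- **The VERTEX `𝔑 = ker ε = 𝔪·G₀ ⊕ G₊` is a maximal ideal of `G(F)`.** [folklore] -/
theorem ker_aug_isMaximal (hI : F.I 1 ≠ ⊤) : (RingHom.ker (aug F hI)).IsMaximal :=
  RingHom.ker_isMaximal_of_surjective (aug F hI) (aug_surjective F hI)

/-- **Every proper homogeneous ideal of `G(F)` lies in the vertex**: a homogeneous element of `I` of positive degree is killed by `ε`; one of
degree `0` is `x̄` for `x ∈ 𝒪`, and `x ∉ 𝔪` would make it a unit. [folklore] -/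
theorem le_ker_aug_of_isHomogeneous (hI : F.I 1 ≠ ⊤) (I : Ideal (assocGraded F))
    (hhom : letI := gradedRing F; I.IsHomogeneous (gradedPiece F)) (hne : I ≠ ⊤) :
    I ≤ RingHom.ker (aug F hI) := by
  classical
  letI := gradedRing F
  -- homogeneous elements of `I` lie in the vertex
  have hpiece : ∀ (n : ℕ) (y : assocGraded F), y ∈ gradedPiece F n → y ∈ I → y ∈ RingHom.ker (aug F hI) := by
    intro n y hy hyI
    obtain ⟨a, ha, rfl⟩ := (mem_gradedPiece_iff F).mp hy
    rw [RingHom.mem_ker]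
    rcases Nat.eq_zero_or_pos n with rfl | hn
    · rw [homogBar_zero_eq_algebraMap, aug_algebraMap, residue_eq_zero_iff]
      by_contra hx
      apply hne
      have ha' : IsUnit a := by simpa [IsLocalRing.mem_maximalIdeal, mem_nonunits_iff] using hx
      have hu : IsUnit (algebraMap 𝒪 (assocGraded F) a) := ha'.map _
      rw [homogBar_zero_eq_algebraMap] at hyI
      exact Ideal.eq_top_of_isUnit_mem I hyI hu
    · exact aug_homogBar F hI n hn a ha
  intro x hx
  rw [← DirectSum.sum_support_decompose (gradedPiece F) x]
  refine Ideal.sum_mem _ fun n _ => hpiece n _ (SetLike.coe_mem _) (hhom n hx)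

omit [IsLocalRing 𝒪] in
/-- If `I₁ = 𝒪` then `G(F)` is the zero ring (`T·T⁻¹ = 1` with `T = 1·T¹ ∈ 𝓡(F)`). [plumbing] -/
theorem subsingleton_of_I_one_eq_top (hI : F.I 1 = ⊤) : Subsingleton (assocGraded F) := by
  have h1 : (1 : 𝒪) ∈ F.I 1 := by rw [hI]; trivial
  have hunit : Ideal.span {sInv F} = ⊤ := by
    rw [Ideal.eq_top_iff_one, Ideal.mem_span_singleton']
    refine ⟨homog F 1 1 h1, Subtype.ext ?_⟩
    change C (1 : 𝒪) * T ((1 : ℕ) : ℤ) * T (-1) = 1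
    rw [map_one, one_mul, ← T_add]
    norm_num
  exact Ideal.Quotient.subsingleton_iff.mpr hunit

/-! ## §2 The bridge in the §3d shape

All localisation plumbing is done INSIDE the proof, after pinning `CommRing (assocGraded F)` with `letI`: on the quotient-of-subalgebra
cone the unifier does not solve `CommSemiring.toSemiring ?_ =?= Ideal.Quotient.semiring _` unaided (res-D-pv-019's 20:25Z report), so no
statement of this file mentions `Localization.AtPrime` of an ideal of `G(F)` itself. -/

/-- **THE HASHIMOTO BRIDGE `cmfiCl_of_vertex_of_hashimoto`** (ThmDSig §3d `cmfiCl_of_vertex`, with the Veronese binder `hV` replaced by its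
consequence «`G(F)` Noetherian», which is what Hashimoto's theorem consumes): for a Noetherian local `(𝒪, 𝔪)` of prime characteristic `p` and a
multiplicative filtration `F` with `G(F)` Noetherian, if the CM clause and the F-clause hold at every maximal ideal `𝔑` of `G(F)[1/1̄·T⁰]`
containing the image of `𝔪` and every `ā·Tⁿ` (`n ≥ 1`) — the VERTEX — then they hold at EVERY prime of `G(F)[1/1̄·T⁰]`.
PROOF: `GradedVertexCMFI.cmfi_atPrime_of_vertex` (Hashimoto Cor. 4.7 + Cor. 5.2) over the grading `AssocGradedGrading.gradedRing F`, at the vertex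
`ker ε` (§1), transported along `G(F) ≅ G(F)[1/1̄·T⁰]`. [OURS · conditional-result] [cite: Hashimoto2010, Cor. 4.7; Cor. 5.2] -/
theorem cmfiCl_of_vertex_of_hashimoto
    (hH : ∀ (p : ℕ) [Fact p.Prime] (A : Type) [CommRing A] [IsNoetherianRing A] [CharP A p]
      (𝒜 : ℕ → AddSubgroup A) [GradedRing 𝒜] (P : Ideal A) [P.IsPrime] [(P.homogeneousCore 𝒜).toIdeal.IsPrime],
      ((∀ d : ℕ, ringKrullDim (Localization.AtPrime (P.homogeneousCore 𝒜).toIdeal) = d →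
          ∀ s : Fin d → Localization.AtPrime (P.homogeneousCore 𝒜).toIdeal, (Ideal.span (Set.range s)).radical.IsMaximal →
            RingTheory.Sequence.IsWeaklyRegular (Localization.AtPrime (P.homogeneousCore 𝒜).toIdeal) (List.ofFn s)) ∧
        (∀ d : ℕ, ringKrullDim (Localization.AtPrime (P.homogeneousCore 𝒜).toIdeal) = d →
          ∀ s : Fin d → Localization.AtPrime (P.homogeneousCore 𝒜).toIdeal, (Ideal.span (Set.range s)).radical.IsMaximal →
            ∀ y : Localization.AtPrime (P.homogeneousCore 𝒜).toIdeal,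
              (∃ e : ℕ, y ^ p ^ e ∈ Ideal.span ((fun z : Localization.AtPrime (P.homogeneousCore 𝒜).toIdeal => z ^ p ^ e) ''
                (Ideal.span (Set.range s) : Set (Localization.AtPrime (P.homogeneousCore 𝒜).toIdeal)))) →
              y ∈ Ideal.span (Set.range s))) →
      ((∀ d : ℕ, ringKrullDim (Localization.AtPrime P) = d →
          ∀ s : Fin d → Localization.AtPrime P, (Ideal.span (Set.range s)).radical.IsMaximal →
            RingTheory.Sequence.IsWeaklyRegular (Localization.AtPrime P) (List.ofFn s)) ∧
        (∀ d : ℕ, ringKrullDim (Localization.AtPrime P) = d →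
          ∀ s : Fin d → Localization.AtPrime P, (Ideal.span (Set.range s)).radical.IsMaximal →
            ∀ y : Localization.AtPrime P,
              (∃ e : ℕ, y ^ p ^ e ∈ Ideal.span ((fun z : Localization.AtPrime P => z ^ p ^ e) ''
                (Ideal.span (Set.range s) : Set (Localization.AtPrime P)))) →
              y ∈ Ideal.span (Set.range s))))
    (hL : Literature.RingTheory.TightClosure.Hashimoto2010_cmfiLocalizes.{0})
    (p : ℕ) [Fact p.Prime] (𝒪 : Type) [CommRing 𝒪] [IsNoetherianRing 𝒪] [IsLocalRing 𝒪] [CharP 𝒪 p]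
    (F : MultFiltration 𝒪) (hNoeth : IsNoetherianRing (assocGraded F))
    (h𝔑 : ∀ (𝔑 : Ideal (Localization.Away (homogBar F 0 1 (one_mem_I_zero 𝒪 F)))) [𝔑.IsMaximal],
      ((∀ x ∈ maximalIdeal 𝒪, algebraMap 𝒪 (Localization.Away (homogBar F 0 1 (one_mem_I_zero 𝒪 F))) x ∈ 𝔑) ∧
        ∀ (n : ℕ), 0 < n → ∀ (a : 𝒪) (ha : a ∈ F.I n),
          (OreLocalization.numeratorRingHom (homogBar F n a ha) : Localization.Away (homogBar F 0 1 (one_mem_I_zero 𝒪 F))) ∈ 𝔑) →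
      SliceableCentre.CMCl (Localization.AtPrime 𝔑) ∧ SliceableCentre.FCl p (Localization.AtPrime 𝔑)) :
    ∀ (𝔓 : Ideal (Localization.Away (homogBar F 0 1 (one_mem_I_zero 𝒪 F)))) [𝔓.IsPrime],
      SliceableCentre.CMCl (Localization.AtPrime 𝔓) ∧ SliceableCentre.FCl p (Localization.AtPrime 𝔓) := by
  classical
  intro 𝔓' h𝔓'
  -- pin the ring structure of `G(F)` (see the §2 note)
  letI : CommRing (assocGraded F) := Ideal.Quotient.commRing (Ideal.span {sInv F})
  -- `G(F)` is non-trivial (it has a prime after localising at `1`), so `I₁ ≠ 𝒪`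
  haveI : Nontrivial (Localization.Away (homogBar F 0 1 (one_mem_I_zero 𝒪 F))) :=
    ⟨⟨0, 1, fun h => h𝔓'.ne_top ((Ideal.eq_top_iff_one _).mpr (h ▸ 𝔓'.zero_mem))⟩⟩
  haveI hnt : Nontrivial (assocGraded F) :=
    (algebraMap (assocGraded F) (Localization.Away (homogBar F 0 1 (one_mem_I_zero 𝒪 F)))).domain_nontrivial
  have hI : F.I 1 ≠ ⊤ := fun h =>
    (not_subsingleton_iff_nontrivial.mpr hnt) (subsingleton_of_I_one_eq_top F h)
  haveI : IsNoetherianRing (assocGraded F) := hNoeth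
  haveI : CharP (assocGraded F) p := by
    have hp : (p : assocGraded F) = 0 := by
      rw [← map_natCast (algebraMap 𝒪 (assocGraded F)), CharP.cast_eq_zero, map_zero]
    exact (CharP.charP_iff_prime_eq_zero Fact.out).mpr hp
  letI := gradedRing F
  -- (a) `φ : G(F) → G' = G(F)[1/1]` is surjective and the powers of `1̄·T⁰ = 1` miss every proper ideal
  have hφsurj : Function.Surjective (algebraMap (assocGraded F) (Localization.Away (homogBar F 0 1 (one_mem_I_zero 𝒪 F)))) := by
    intro y
    obtain ⟨⟨x, s⟩, h⟩ := IsLocalization.surj (Submonoid.powers (homogBar F 0 1 (one_mem_I_zero 𝒪 F))) y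
    obtain ⟨n, hn⟩ := (Submonoid.mem_powers_iff _ _).mp s.2
    have hs : (s : assocGraded F) = 1 := by rw [← hn, homogBar_zero_one, one_pow]
    refine ⟨x, ?_⟩
    have h' : y * algebraMap _ _ (s : assocGraded F) = algebraMap _ _ x := h
    rw [hs, map_one, mul_one] at h'
    exact h'.symm
  have hdisj : ∀ I : Ideal (assocGraded F), I ≠ ⊤ →
      Disjoint (Submonoid.powers (homogBar F 0 1 (one_mem_I_zero 𝒪 F)) : Set (assocGraded F)) (I : Set (assocGraded F)) := by
    intro I hI'
    rw [Set.disjoint_left]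
    rintro y ⟨n, rfl⟩ hy
    apply hI'
    rw [Ideal.eq_top_iff_one]
    have h : (fun k : ℕ => homogBar F 0 1 (one_mem_I_zero 𝒪 F) ^ k) n = 1 := by
      change homogBar F 0 1 (one_mem_I_zero 𝒪 F) ^ n = 1
      rw [homogBar_zero_one, one_pow]
    rwa [h] at hy
  -- (b) the clauses at a prime `𝔔'` of `G'` are those at `𝔔' ∩ G(F)` (`G'_𝔔'` is `G(F)` localised at `𝔔' ∩ G(F)`)
  have htrans : ∀ (𝔔' : Ideal (Localization.Away (homogBar F 0 1 (one_mem_I_zero 𝒪 F)))) (h𝔔' : 𝔔'.IsPrime),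
      Nonempty (Localization.AtPrime
        (Ideal.comap (algebraMap (assocGraded F) (Localization.Away (homogBar F 0 1 (one_mem_I_zero 𝒪 F)))) 𝔔') ≃+*
        Localization.AtPrime 𝔔') := by
    intro 𝔔' h𝔔'
    let 𝔔 : Ideal (assocGraded F) :=
      Ideal.comap (algebraMap (assocGraded F) (Localization.Away (homogBar F 0 1 (one_mem_I_zero 𝒪 F)))) 𝔔'
    haveI h𝔔 : 𝔔.IsPrime := Ideal.comap_isPrime _ 𝔔'
    haveI hat : IsLocalization.AtPrime (Localization.AtPrime 𝔔') 𝔔 :=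
      IsLocalization.isLocalization_isLocalization_atPrime_isLocalization
        (Submonoid.powers (homogBar F 0 1 (one_mem_I_zero 𝒪 F))) (Localization.AtPrime 𝔔') 𝔔'
    exact ⟨(IsLocalization.algEquiv (R := assocGraded F) 𝔔.primeCompl (Localization.AtPrime 𝔔) (Localization.AtPrime 𝔔')).toRingEquiv⟩
  -- (c) the vertex `𝔑 = ker ε` and its extension `𝔑'` to `G'`
  haveI h𝔑max : (RingHom.ker (aug F hI)).IsMaximal := ker_aug_isMaximal F hI
  have hunder : Ideal.comap (algebraMap (assocGraded F) (Localization.Away (homogBar F 0 1 (one_mem_I_zero 𝒪 F))))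
      ((RingHom.ker (aug F hI)).map (algebraMap (assocGraded F) (Localization.Away (homogBar F 0 1 (one_mem_I_zero 𝒪 F))))) =
      RingHom.ker (aug F hI) :=
    IsLocalization.under_map_of_isPrime_disjoint (Submonoid.powers (homogBar F 0 1 (one_mem_I_zero 𝒪 F)))
      (Localization.Away (homogBar F 0 1 (one_mem_I_zero 𝒪 F))) h𝔑max.isPrime (hdisj _ h𝔑max.ne_top)
  haveI h𝔑'max : ((RingHom.ker (aug F hI)).map
      (algebraMap (assocGraded F) (Localization.Away (homogBar F 0 1 (one_mem_I_zero 𝒪 F))))).IsMaximal := by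
    refine (Ideal.map_eq_top_or_isMaximal_of_surjective _ hφsurj h𝔑max).resolve_left fun htop => ?_
    apply h𝔑max.ne_top
    rw [← hunder, htop, Ideal.comap_top]
  -- (d) `𝔑'` satisfies the vertex condition, hence is CMFI by hypothesis
  have hV : (∀ x ∈ maximalIdeal 𝒪, algebraMap 𝒪 (Localization.Away (homogBar F 0 1 (one_mem_I_zero 𝒪 F))) x ∈
        (RingHom.ker (aug F hI)).map (algebraMap (assocGraded F) (Localization.Away (homogBar F 0 1 (one_mem_I_zero 𝒪 F))))) ∧
      ∀ (n : ℕ), 0 < n → ∀ (a : 𝒪) (ha : a ∈ F.I n),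
        (OreLocalization.numeratorRingHom (homogBar F n a ha) : Localization.Away (homogBar F 0 1 (one_mem_I_zero 𝒪 F))) ∈
          (RingHom.ker (aug F hI)).map (algebraMap (assocGraded F) (Localization.Away (homogBar F 0 1 (one_mem_I_zero 𝒪 F)))) := by
    constructor
    · intro x hx
      have hx' : algebraMap 𝒪 (assocGraded F) x ∈ RingHom.ker (aug F hI) := by
        rw [RingHom.mem_ker, aug_algebraMap, residue_eq_zero_iff]
        exact hx
      exact Ideal.mem_map_of_mem _ hx'
    · intro n hn a ha
      have ha' : homogBar F n a ha ∈ RingHom.ker (aug F hI) := by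
        rw [RingHom.mem_ker]
        exact aug_homogBar F hI n hn a ha
      exact Ideal.mem_map_of_mem _ ha'
  obtain ⟨e𝔑⟩ := htrans _ h𝔑'max.isPrime
  have hcm𝔑' := h𝔑 _ hV
  have hcm𝔑 := GradedVertexCMFI.clauses_atPrime_of_eq p hunder
    ⟨FiLocusOpenOfAffine.cmClause_of_ringEquiv e𝔑.symm hcm𝔑'.1, FiLocusOpenOfAffine.fClause_of_ringEquiv p e𝔑.symm hcm𝔑'.2⟩
  -- (e) Hashimoto: every prime of `G(F)` is CMFI
  have hall := GradedVertexCMFI.cmfi_atPrime_of_vertex hH hL p (gradedPiece F) (RingHom.ker (aug F hI))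
    (fun I hIh hne => le_ker_aug_of_isHomogeneous F hI I hIh hne) hcm𝔑
  -- (f) back to `G'`
  obtain ⟨e⟩ := htrans 𝔓' h𝔓'
  obtain ⟨hCM, hF⟩ := hall
    (Ideal.comap (algebraMap (assocGraded F) (Localization.Away (homogBar F 0 1 (one_mem_I_zero 𝒪 F)))) 𝔓')
  exact ⟨FiLocusOpenOfAffine.cmClause_of_ringEquiv e hCM, FiLocusOpenOfAffine.fClause_of_ringEquiv p e hF⟩

end Summit.ResolutionOfSingularities.ResolutionOfSingularities.Theorems.FInjectiveMacaulayfication.AssocGradedVertex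

end
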